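import Literature.NumberTheory.EllipticCurves.LocalTateSelfDualityTorsion
import HarnessLib

/-!
# The level-`n` local Tate self-pairing of `E[n]` is perfect for EVERY invariant isomorphism `H²(Γ_F, μₙ) ⥲ ℤ/n`

Topic `NumberTheory/EllipticCurves`; namespace `Literature.NumberTheory.EllipticCurves`. Proof file (theorems only:
no definition, no named fact, no instance, no `sorry`) of `LocalTateSelfDualityTorsion.lean` (brick K2 floor (a) of the
hT₂ programme of crux K★ stmt-BirchSwinnertonDyer-22226): there, `exists_levelTatePairing_bijective` gives SOME
injective `ι₀ : H²(Γ_F, μₙ) → ℤ/n` for which both adjoints of `⟨x, y⟩_{ι₀} = ι₀(x ∪ₑ y)` on `H¹(F, E[n]|_{Γ_F})` are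
bijective (the tree's `localDuality_bijective`). Here (floor (b), first half): **the same holds for every BIJECTIVE
`ι`** — in particular for THE invariant map `inv_F` of local class field theory (the tree's
`Prop121vii.invLevel F n`, bijective by `invLevel_bijective`), which is the normalisation needed to pass to the limit
over `n = p^k`. Argument (Serre II §5.2 / the tree's `LocalInvariants.isPerfect_of_bijective` in the number-field
dialect): `H²(Γ_F, μₙ)` embeds into `ℤ/n` by `ι₀` and is equipotent to `ℤ/n` by `ι`, so `ι₀` is bijective too and
`ι = ι₀ · u` for a unit `u ∈ (ℤ/n)ˣ` (an additive automorphism of `ℤ/n` is multiplication by its value at `1`);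
`⟨·,·⟩_ι = ⟨·,·⟩_{ι₀} · u` and post-multiplication by a unit preserves bijectivity of both adjoints.

* (private) `AddMonoidHom.exists_units_eq_mul_of_bijective` — two bijective additive maps `A → ℤ/n` differ by a
  unit; (private) `AddMonoidHom.bijective_of_forall_eq_mul_units` — `P' = P · u` (`u` a unit) and `P` bijective ⇒ `P'`
  bijective, for pairings `A →+ B →+ ℤ/n`;
* ★ `levelTatePairing_bijective_of_bijective` — both adjoints of `⟨·,·⟩_ι` bijective for every bijective `ι`.

BSD is not proved by any of this.

## References
* J.-P. Serre, *Galois Cohomology*, Springer 1997, II §5.2 Thm. 2. [SerreGaloisCohomology1997]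
* J. S. Milne, *Arithmetic Duality Theorems*, 2nd ed. 2006, I Cor. 2.3. [MilneADT2006]
-/

noncomputable section

open Function Field
open Literature.NumberTheory.GaloisRepresentations
open Literature.NumberTheory.GaloisRepresentations.DiscreteGaloisModule (mu MuCarrier)

universe u v w

/-! ### Additive maps into `ℤ/n` -/

namespace AddMonoidHom

/-- An additive endomorphism `α` of `ℤ/n` is `z ↦ z · α 1`. [folklore] -/
private theorem zmod_end_apply_eq_mul {n : ℕ} [NeZero n] (α : ZMod n →+ ZMod n) (z : ZMod n) :
    α z = z * α 1 := by
  have hz : z = (z.val : ℤ) • (1 : ZMod n) := by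
    rw [zsmul_eq_mul, mul_one, Int.cast_natCast, ZMod.natCast_zmod_val]
  conv_lhs => rw [hz, map_zsmul]
  rw [zsmul_eq_mul, Int.cast_natCast, ZMod.natCast_zmod_val]

/-- **Two bijective additive maps `A → ℤ/n` differ by a unit**: `ι' = ι · u`, `u ∈ (ℤ/n)ˣ` (the composite
`ι' ∘ ι⁻¹` is an additive automorphism of `ℤ/n`, i.e. multiplication by a unit). [folklore] -/
private theorem exists_units_eq_mul_of_bijective {A : Type v} [AddCommGroup A] {n : ℕ} [NeZero n]
    (ι ι' : A →+ ZMod n) (hι : Bijective ι) (hι' : Bijective ι') :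
    ∃ u : (ZMod n)ˣ, ∀ a, ι' a = ι a * u := by
  let α : ZMod n →+ ZMod n :=
    ι'.comp ((AddEquiv.ofBijective ι hι).symm : ZMod n →+ A)
  have hα : ∀ a, ι' a = ι a * α 1 := fun a => by
    have h : α (ι a) = ι' a := by
      change ι' ((AddEquiv.ofBijective ι hι).symm (ι a)) = ι' a
      rw [show ι a = AddEquiv.ofBijective ι hι a from rfl, AddEquiv.symm_apply_apply]
    rw [← h, zmod_end_apply_eq_mul]
  -- `α 1` is a unit: `α` is onto (`ι'` is), so `z · α 1 = 1` for some `z`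
  obtain ⟨a, ha⟩ := hι'.2 1
  have hu : IsUnit (α 1) :=
    isUnit_iff_exists_inv.mpr ⟨ι a, by rw [mul_comm, ← hα a, ha]⟩
  exact ⟨hu.unit, fun a => by rw [IsUnit.unit_spec]; exact hα a⟩

/-- **Post-multiplication by a unit preserves bijectivity of a pairing's adjoint**: if
`P' a b = P a b · u` for a unit `u` of `ℤ/n` then `P` bijective ⇒ `P'` bijective (as maps `A → (B →+ ℤ/n)`).
[folklore] -/
private theorem bijective_of_forall_eq_mul_units {A : Type v} {B : Type w} [AddCommGroup A] [AddCommGroup B] {n : ℕ}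
    (P P' : A →+ B →+ ZMod n) (u : (ZMod n)ˣ) (h : ∀ a b, P' a b = P a b * u) (hP : Bijective P) :
    Bijective P' := by
  -- `P' = Ψ ∘ P` with `Ψ f = (· * u) ∘ f`, a bijection of `B →+ ℤ/n` (inverse `(· * u⁻¹) ∘ ·`)
  let Ψ : (B →+ ZMod n) → (B →+ ZMod n) := fun f => (AddMonoidHom.mulRight (u : ZMod n)).comp f
  have hΨ : Bijective Ψ := by
    refine Function.bijective_iff_has_inverse.2 ⟨fun f => (AddMonoidHom.mulRight (↑u⁻¹ : ZMod n)).comp f, ?_, ?_⟩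
    · intro f; ext b; simp [Ψ]
    · intro f; ext b; simp [Ψ]
  have hcomp : ⇑P' = Ψ ∘ ⇑P := by
    funext a; ext b; simpa [Ψ] using h a b
  rw [hcomp]
  exact hΨ.comp hP

end AddMonoidHom

namespace Literature.NumberTheory.EllipticCurves

open _root_.WeierstrassCurve

attribute [local instance] absoluteGaloisGroup_compactSpace
attribute [local instance] finite_geomTorsion_of_neZero

variable {K₀ : Type u} [Field K₀] (W : WeierstrassCurve K₀) [W.IsElliptic] (F : Type u) [Field F] [Algebra K₀ F]
  (n : ℕ) [NeZero n]
  (e : geomTorsion W n → geomTorsion W n → AlgebraicClosure K₀)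
  (hμ : ∀ S T, e S T ^ n = 1)
  (hadd₁ : ∀ S₁ S₂ T, e (S₁ + S₂) T = e S₁ T * e S₂ T)
  (hadd₂ : ∀ S T₁ T₂, e S (T₁ + T₂) = e S T₁ * e S T₂)
  (hgal : ∀ (σ : absoluteGaloisGroup K₀) (S T : geomTorsion W n), σ • e S T = e (σ • S) (σ • T))
  (hnondeg : ∀ T, (∀ S, e S T = 1) → T = 0)

/-- The self-pairings for `ι' = ι · u` differ by `u`: `⟨x, y⟩_{ι'} = ⟨x, y⟩_ι · u`. [cite: MilneADT2006, I Cor. 2.3] -/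
theorem levelTatePairing_eq_mul (ι ι' : continuousCohomology 2 (mu F n).toTopRep →+ ZMod n) (u : ZMod n)
    (h : ∀ c, ι' c = ι c * u) (x y : continuousCohomology 1 (torsionRestricted W F n).toTopRep) :
    levelTatePairing W F n e hμ hadd₁ hadd₂ hgal ι' x y = levelTatePairing W F n e hμ hadd₁ hadd₂ hgal ι x y * u := by
  rw [levelTatePairing_apply, levelTatePairing_apply, ContinuousRep.dualityPairing_apply,
    ContinuousRep.dualityPairing_apply, h]

include hnondeg in
/-- ★ **Local Tate self-duality of `E[n]|_{Γ_F}` for EVERY invariant isomorphism**: over a non-archimedean local field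
`F ⊇ K₀` of characteristic `0`, for every BIJECTIVE `ι : H²(Γ_F, μₙ) → ℤ/n` both adjoints of `⟨·,·⟩_ι` are bijective.
[cite: SerreGaloisCohomology1997, II §5.2 Thm. 2] [cite: MilneADT2006, I Cor. 2.3] -/
theorem levelTatePairing_bijective_of_bijective [ValuativeRel F] [TopologicalSpace F] [IsNonarchimedeanLocalField F]
    [CharZero F] (ι : continuousCohomology 2 (mu F n).toTopRep →+ ZMod n) (hι : Bijective ι) :
    Bijective (levelTatePairing W F n e hμ hadd₁ hadd₂ hgal ι) ∧
      Bijective (levelTatePairing W F n e hμ hadd₁ hadd₂ hgal ι).flip := by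
  obtain ⟨ι₀, hι₀, h1, h2⟩ := exists_levelTatePairing_bijective W F n e hμ hadd₁ hadd₂ hgal hnondeg
  -- `ι₀` is bijective too: `H²(Γ_F, μₙ)` is finite of the cardinality of `ℤ/n`
  haveI : Finite (continuousCohomology 2 (mu F n).toTopRep) := Finite.of_injective ι₀ hι₀
  have hcard : Nat.card (continuousCohomology 2 (mu F n).toTopRep) = Nat.card (ZMod n) :=
    Nat.card_eq_of_bijective ι hι
  have hι₀b : Bijective ι₀ := (Nat.bijective_iff_injective_and_card ι₀).2 ⟨hι₀, hcard⟩
  obtain ⟨u, hu⟩ := AddMonoidHom.exists_units_eq_mul_of_bijective ι₀ ι hι₀b hι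
  have h : ∀ x y, levelTatePairing W F n e hμ hadd₁ hadd₂ hgal ι x y =
      levelTatePairing W F n e hμ hadd₁ hadd₂ hgal ι₀ x y * u :=
    levelTatePairing_eq_mul W F n e hμ hadd₁ hadd₂ hgal ι₀ ι u hu
  exact ⟨AddMonoidHom.bijective_of_forall_eq_mul_units _ _ u h h1,
    AddMonoidHom.bijective_of_forall_eq_mul_units (levelTatePairing W F n e hμ hadd₁ hadd₂ hgal ι₀).flip
      (levelTatePairing W F n e hμ hadd₁ hadd₂ hgal ι).flip u (fun y x => h x y) h2⟩

end Literature.NumberTheory.EllipticCurves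

end
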